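import Summits.CriticalPhenomena.CardyFormulaZ2.Theses.CardyMagicRigidity
import Literature.Probability.RandomPlanarGeometry.LoopConfigurationsBlind
import Literature.Probability.Percolation.FullPlaneCNL
import HarnessLib

/-!
# Coupling plumbing for the tomographic transfer (stub S4 of line `pinch-resampling`, crux `NestingRigidity`)

Crux `Summit.CriticalPhenomena.CardyFormulaZ2.Theses.CardyMagicRigidity.NestingRigidity`
(stmt-CriticalPhenomena-4835), line `pinch-resampling` v2, registered stub
`stub_tomographicTransfer : FourArmCouplingT → FourArmCouplingZ2 → LoopLimitZ2Blind → LoopLimitZ2EqT`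
(vocabulary `Theorems/CardyMagicRigidityPinchResamplingDefs.lean`).  This file is the sorry-free PLUMBING of that
stub on the TARGET side (brick B1 of the S4 brief; the hypothesis side `LoopLimitZ2Blind`, which needs the Defs
module, is the companion `…NestingRigidityBlindCouplings`).  It rewrites the route target `LoopLimitZ2EqT` —
convergence to `0` as `δ → 0⁺` of DKKMO's coupling distance `LoopConfig.cnLawEDist` (arXiv:2012.11672v2, eq. (2))
between the law of the typed loop representation `bondLoopConfig δ 0` of critical bond percolation on `δℤ²` and the
law of the typed honeycomb interface-loop configuration `siteLoopConfig δ` of critical site percolation on `δ𝕋` — and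
its blind analogue (`LoopConfig.blindLawEDist`, `Literature/…/LoopConfigurationsBlind`) as statements about COUPLINGS
at fixed mesh:

* §1 (generic, any index filter `l`, any pair of random configurations):
  `tendsto_cnLawEDist_nhds_zero_iff` — `cnLawEDist → 0` along `l` iff for every `η > 0`, eventually along `l` there is a
  coupling `P` of the two laws with `P[¬ IsClose η] < η`; `tendsto_blindLawEDist_nhds_zero_iff` — the same for
  `blindLawEDist` / `IsBlindClose`; and `tendsto_cnLawEDist_nhds_zero_of_improvement` — if for every `η > 0` there is
  `ε > 0` such that, eventually, EVERY coupling with `P[¬ IsBlindClose ε] < ε` can be replaced by a coupling with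
  `P'[¬ IsClose η] < η`, then `blindLawEDist → 0` implies `cnLawEDist → 0`.
* §2 (the concrete laws): `loopLimitZ2EqT_of_couplings` (anchor, registered signature), its converse
  `couplings_of_loopLimitZ2EqT`, the equivalence `loopLimitZ2EqT_iff_couplings`, and the REDUCTION of the transfer to a
  coupling-improvement statement at fixed `(η, ε, δ)` from blind convergence of the two lattice laws:
  `loopLimitZ2EqT_of_tendsto_blindLawEDist_of_improvement`.

All proofs are order-theoretic (`ENNReal.tendsto_nhds_zero`) on top of the Literature API `cnLawEDist_le_of_coupling`,
`exists_coupling_of_cnLawEDist_lt`, `blindLawEDist_le_of_coupling`, `exists_coupling_of_blindLawEDist_lt`; the route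
target is unfolded definitionally (`siteLoopConfig_eq` is `rfl`).  Nothing here touches the mechanism (neck tomography)
of the stub; see the audit `S4-audit.md` of seat c5-0 (item evidence).
-/

noncomputable section

namespace Summit.CriticalPhenomena.CardyFormulaZ2.Cruxes.NestingRigidity.PinchResampling

open Summit.CriticalPhenomena.CardyFormulaZ2.Theses.CardyMagicRigidity
open MeasureTheory Filter Literature.Probability.Percolation Literature.Probability.LatticeModels
  Literature.Probability.RandomPlanarGeometry
open scoped ENNReal Topology

/-! ## §1 Generic: `ℝ≥0∞`-valued coupling distances tending to `0` -/

section Generic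

variable {ι Ω Ω' : Type*} [MeasurableSpace Ω] [MeasurableSpace Ω'] {l : Filter ι}
  {μ : Measure Ω} {μ' : Measure Ω'}

/-- An `ℝ≥0∞`-valued family tends to `0` along `l` iff for every real `η > 0` it is eventually `≤ ENNReal.ofReal η`
(test values `ofReal η` suffice: every positive extended real dominates one of them). -/
theorem tendsto_nhds_zero_iff_forall_ofReal {f : ι → ℝ≥0∞} :
    Tendsto f l (𝓝 0) ↔ ∀ η : ℝ, 0 < η → ∀ᶠ i in l, f i ≤ ENNReal.ofReal η := by
  rw [ENNReal.tendsto_nhds_zero]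
  constructor
  · intro h η hη
    exact h (ENNReal.ofReal η) (ENNReal.ofReal_pos.2 hη)
  · intro h e he
    rcases eq_or_ne e ⊤ with rfl | hne
    · exact Eventually.of_forall fun i ↦ le_top
    · have hpos : 0 < e.toReal := ENNReal.toReal_pos he.ne' hne
      filter_upwards [h e.toReal hpos] with i hi
      rwa [ENNReal.ofReal_toReal hne] at hi

/-- An `ℝ≥0∞`-valued family tends to `0` along `l` iff for every real `η > 0` it is eventually `< ENNReal.ofReal η`. -/
theorem tendsto_nhds_zero_iff_forall_lt_ofReal {f : ι → ℝ≥0∞} :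
    Tendsto f l (𝓝 0) ↔ ∀ η : ℝ, 0 < η → ∀ᶠ i in l, f i < ENNReal.ofReal η := by
  rw [tendsto_nhds_zero_iff_forall_ofReal]
  constructor
  · intro h η hη
    filter_upwards [h (η / 2) (half_pos hη)] with i hi
    exact hi.trans_lt (ENNReal.ofReal_lt_ofReal_iff'.2 ⟨half_lt_self hη, hη⟩)
  · intro h η hη
    filter_upwards [h η hη] with i hi
    exact hi.le

/-- **`d_CN`-convergence of laws as couplings.**  For random configurations `X i`, `X' i` (indexed by `i`, e.g. the
mesh) under fixed laws `μ`, `μ'`: `cnLawEDist μ (X i) μ' (X' i) → 0` along `l` iff for every `η > 0`, eventually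
along `l`, there is a coupling `P` of `μ` and `μ'` with `P[d_CN(X i, X' i) > η] < η` (DKKMO arXiv:2012.11672v2,
eq. (2): `cnLawEDist_le_of_coupling`, `exists_coupling_of_cnLawEDist_lt`). -/
theorem tendsto_cnLawEDist_nhds_zero_iff {E : Type*} [NormedAddCommGroup E]
    {X : ι → Ω → LoopConfig E} {X' : ι → Ω' → LoopConfig E} :
    Tendsto (fun i ↦ LoopConfig.cnLawEDist μ (X i) μ' (X' i)) l (𝓝 0) ↔
      ∀ η : ℝ, 0 < η → ∀ᶠ i in l, ∃ P : Measure (Ω × Ω'), P.map Prod.fst = μ ∧ P.map Prod.snd = μ' ∧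
        P {p | ¬ LoopConfig.IsClose η (X i p.1) (X' i p.2)} < ENNReal.ofReal η := by
  constructor
  · intro h η hη
    filter_upwards [(tendsto_nhds_zero_iff_forall_lt_ofReal.1 h) η hη] with i hi
    exact LoopConfig.exists_coupling_of_cnLawEDist_lt hi
  · intro h
    refine tendsto_nhds_zero_iff_forall_ofReal.2 fun η hη ↦ ?_
    filter_upwards [h η hη] with i hi
    obtain ⟨P, h₁, h₂, hP⟩ := hi
    exact LoopConfig.cnLawEDist_le_of_coupling hη P h₁ h₂ hP

/-- **Blind convergence of laws as couplings.**  `blindLawEDist μ (X i) μ' (X' i) → 0` along `l` iff for every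
`ε > 0`, eventually along `l`, there is a coupling `P` of `μ` and `μ'` with `P[¬ IsBlindClose ε] < ε`
(`blindLawEDist_le_of_coupling`, `exists_coupling_of_blindLawEDist_lt`). -/
theorem tendsto_blindLawEDist_nhds_zero_iff
    {X : ι → Ω → LoopConfig ℂ} {X' : ι → Ω' → LoopConfig ℂ} :
    Tendsto (fun i ↦ LoopConfig.blindLawEDist μ (X i) μ' (X' i)) l (𝓝 0) ↔
      ∀ ε : ℝ, 0 < ε → ∀ᶠ i in l, ∃ P : Measure (Ω × Ω'), P.map Prod.fst = μ ∧ P.map Prod.snd = μ' ∧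
        P {p | ¬ LoopConfig.IsBlindClose ε (X i p.1) (X' i p.2)} < ENNReal.ofReal ε := by
  constructor
  · intro h ε hε
    filter_upwards [(tendsto_nhds_zero_iff_forall_lt_ofReal.1 h) ε hε] with i hi
    exact LoopConfig.exists_coupling_of_blindLawEDist_lt hi
  · intro h
    refine tendsto_nhds_zero_iff_forall_ofReal.2 fun ε hε ↦ ?_
    filter_upwards [h ε hε] with i hi
    obtain ⟨P, h₁, h₂, hP⟩ := hi
    exact LoopConfig.blindLawEDist_le_of_coupling hε P h₁ h₂ hP

/-- **Coupling improvement transfers blind convergence to `d_CN`-convergence.**  If for every target precision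
`η > 0` there is a blind precision `ε > 0` such that, eventually along `l`, every coupling `P` of `μ`, `μ'` with
`P[¬ IsBlindClose ε (X i) (X' i)] < ε` can be replaced by a coupling `P'` with `P'[¬ IsClose η (X i) (X' i)] < η`,
then `blindLawEDist → 0` implies `cnLawEDist → 0`.  This is the exact shape to which the tomographic transfer reduces:
a coupling-improvement statement at fixed `(η, ε, i)`. -/
theorem tendsto_cnLawEDist_nhds_zero_of_improvement
    {X : ι → Ω → LoopConfig ℂ} {X' : ι → Ω' → LoopConfig ℂ}
    (himp : ∀ η : ℝ, 0 < η → ∃ ε : ℝ, 0 < ε ∧ ∀ᶠ i in l, ∀ P : Measure (Ω × Ω'),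
      P.map Prod.fst = μ → P.map Prod.snd = μ' →
      P {p | ¬ LoopConfig.IsBlindClose ε (X i p.1) (X' i p.2)} < ENNReal.ofReal ε →
      ∃ P' : Measure (Ω × Ω'), P'.map Prod.fst = μ ∧ P'.map Prod.snd = μ' ∧
        P' {p | ¬ LoopConfig.IsClose η (X i p.1) (X' i p.2)} < ENNReal.ofReal η)
    (hblind : Tendsto (fun i ↦ LoopConfig.blindLawEDist μ (X i) μ' (X' i)) l (𝓝 0)) :
    Tendsto (fun i ↦ LoopConfig.cnLawEDist μ (X i) μ' (X' i)) l (𝓝 0) := by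
  rw [tendsto_cnLawEDist_nhds_zero_iff]
  rw [tendsto_blindLawEDist_nhds_zero_iff] at hblind
  intro η hη
  obtain ⟨ε, hε, hev⟩ := himp η hη
  filter_upwards [hev, hblind ε hε] with i hi hb
  obtain ⟨P, h₁, h₂, hP⟩ := hb
  exact hi P h₁ h₂ hP

end Generic

/-! ## §2 The concrete laws: `P_{1/2}` on `ℤ²`-bonds and on `𝕋`-sites -/

/-- **B1, target side (registered helper anchor).**  If for every `η > 0`, for all small meshes `δ > 0`, there is a
coupling `P` of critical bond percolation on `ℤ²` and critical site percolation on `𝕋` under which the typed loop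
configurations `bondLoopConfig δ 0` and `siteLoopConfig δ` fail to be `η`-close in DKKMO's sense (`LoopConfig.IsClose`:
`udist`-partners of the same type for every loop in the window `B(0, 1/η)`) with probability `< η`, then the route
target `LoopLimitZ2EqT` holds (the target is this `Tendsto` statement by `rfl`, `siteLoopConfig_eq`; then
`cnLawEDist_le_of_coupling`). -/
theorem loopLimitZ2EqT_of_couplings : (∀ η : ℝ, 0 < η → ∀ᶠ δ in nhdsWithin (0:ℝ) (Set.Ioi 0), ∃ P : Measure (BondConfig (Site 2) × SiteConfig (Site 2)), P.map Prod.fst = bondPercolation (zdGraph 2) half ∧ P.map Prod.snd = triSitePercolation half ∧ P {p | ¬ LoopConfig.IsClose η (bondLoopConfig δ 0 p.1) (siteLoopConfig δ p.2)} < ENNReal.ofReal η) → LoopLimitZ2EqT := by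
  intro h
  show Tendsto (fun δ : ℝ ↦ LoopConfig.cnLawEDist (bondPercolation (zdGraph 2) half) (bondLoopConfig δ 0)
    (triSitePercolation half) (siteLoopConfig δ)) (nhdsWithin 0 (Set.Ioi 0)) (𝓝 0)
  exact tendsto_cnLawEDist_nhds_zero_iff.2 h

/-- Converse of `loopLimitZ2EqT_of_couplings`: the target supplies, for every `η > 0` and all small `δ`, a coupling with
`P[¬ IsClose η] < η` (`exists_coupling_of_cnLawEDist_lt`). -/
theorem couplings_of_loopLimitZ2EqT (hX : LoopLimitZ2EqT) :
    ∀ η : ℝ, 0 < η → ∀ᶠ δ in nhdsWithin (0:ℝ) (Set.Ioi 0),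
      ∃ P : Measure (BondConfig (Site 2) × SiteConfig (Site 2)),
        P.map Prod.fst = bondPercolation (zdGraph 2) half ∧ P.map Prod.snd = triSitePercolation half ∧
        P {p | ¬ LoopConfig.IsClose η (bondLoopConfig δ 0 p.1) (siteLoopConfig δ p.2)} < ENNReal.ofReal η := by
  have hX' : Tendsto (fun δ : ℝ ↦ LoopConfig.cnLawEDist (bondPercolation (zdGraph 2) half) (bondLoopConfig δ 0)
      (triSitePercolation half) (siteLoopConfig δ)) (nhdsWithin 0 (Set.Ioi 0)) (𝓝 0) := hX
  exact tendsto_cnLawEDist_nhds_zero_iff.1 hX'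

/-- `LoopLimitZ2EqT` is EQUIVALENT to the coupling statement of `loopLimitZ2EqT_of_couplings`. -/
theorem loopLimitZ2EqT_iff_couplings :
    LoopLimitZ2EqT ↔ ∀ η : ℝ, 0 < η → ∀ᶠ δ in nhdsWithin (0:ℝ) (Set.Ioi 0),
      ∃ P : Measure (BondConfig (Site 2) × SiteConfig (Site 2)),
        P.map Prod.fst = bondPercolation (zdGraph 2) half ∧ P.map Prod.snd = triSitePercolation half ∧
        P {p | ¬ LoopConfig.IsClose η (bondLoopConfig δ 0 p.1) (siteLoopConfig δ p.2)} < ENNReal.ofReal η :=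
  ⟨couplings_of_loopLimitZ2EqT, loopLimitZ2EqT_of_couplings⟩

/-- **Reduction of the transfer to coupling improvement at fixed mesh.**  Blind convergence of the two lattice laws
(`blindLawEDist (P^{ℤ²}_{1/2}, bondLoopConfig δ 0) (P^{𝕋}_{1/2}, siteLoopConfig δ) → 0`, which is `LoopLimitZ2Blind` of
the Defs module by `Iff.rfl`) gives the target `LoopLimitZ2EqT` as soon as: for every `η > 0` there is `ε > 0` such
that for all small `δ > 0`, EVERY coupling `P` of the two critical measures with
`P[¬ IsBlindClose ε (bondLoopConfig δ 0) (siteLoopConfig δ)] < ε` can be replaced by a coupling `P'` (same marginals)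
with `P'[¬ IsClose η (bondLoopConfig δ 0) (siteLoopConfig δ)] < η`.  The neck tomography of `stub_tomographicTransfer`
is meant to produce exactly this improvement (re-coupling of the routing data); this lemma is the bookkeeping around it. -/
theorem loopLimitZ2EqT_of_tendsto_blindLawEDist_of_improvement
    (himp : ∀ η : ℝ, 0 < η → ∃ ε : ℝ, 0 < ε ∧ ∀ᶠ δ in nhdsWithin (0:ℝ) (Set.Ioi 0),
      ∀ P : Measure (BondConfig (Site 2) × SiteConfig (Site 2)),
        P.map Prod.fst = bondPercolation (zdGraph 2) half → P.map Prod.snd = triSitePercolation half →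
        P {p | ¬ LoopConfig.IsBlindClose ε (bondLoopConfig δ 0 p.1) (siteLoopConfig δ p.2)} < ENNReal.ofReal ε →
        ∃ P' : Measure (BondConfig (Site 2) × SiteConfig (Site 2)),
          P'.map Prod.fst = bondPercolation (zdGraph 2) half ∧ P'.map Prod.snd = triSitePercolation half ∧
          P' {p | ¬ LoopConfig.IsClose η (bondLoopConfig δ 0 p.1) (siteLoopConfig δ p.2)} < ENNReal.ofReal η)
    (hblind : Tendsto (fun δ : ℝ ↦ LoopConfig.blindLawEDist (bondPercolation (zdGraph 2) half) (bondLoopConfig δ 0)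
      (triSitePercolation half) (siteLoopConfig δ)) (nhdsWithin 0 (Set.Ioi 0)) (𝓝 0)) : LoopLimitZ2EqT := by
  show Tendsto (fun δ : ℝ ↦ LoopConfig.cnLawEDist (bondPercolation (zdGraph 2) half) (bondLoopConfig δ 0)
    (triSitePercolation half) (siteLoopConfig δ)) (nhdsWithin 0 (Set.Ioi 0)) (𝓝 0)
  exact tendsto_cnLawEDist_nhds_zero_of_improvement himp hblind

end Summit.CriticalPhenomena.CardyFormulaZ2.Cruxes.NestingRigidity.PinchResampling

end
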